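import Summits.AtomisticToContinuum.Crystallization.Theorems.OverbindingBudgetAffineFirmDescent
import Summits.AtomisticToContinuum.Crystallization.Theorems.FrustratedLawDichotomyNashStabilityCalculus

/-!
# `FirmGain` — file A of the SPLIT-400 landing edition (§0 vocabulary, §1 the five lemma statements, §2 glue, §3 L1 `separatedSubfamily` + L4 `jointInjective`)

Route `OverbindingBudget`, leaf (2c) `OverbindingBudgetAffineFirmDescent.FirmGain` ((464) p864425; item stmt-AtomisticToContinuum-31280 line).
Landing edition of lens-4 g107's sorry-free scratch module `FirmGainProved.lean` (sha256 63368a6f…, decomp-a2c; critic r1950 LANDING PLAN (475)):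
this file = its lines 20–326 VERBATIM (namespace `.Brief`, `open` block, `variable {N : ℕ}`, §0–§3); file B (hand-2, (476)) = §4–§5;
file C (hand-2, (477)) = §6–§7 with `theorem firmGain : FirmGain` and the corollary `softGain`.  The five Props of §1 are CLOSED by B/C.
No statement or proof body is edited; only this docstring and the file cut are new.  0 sorry.
-/

namespace Summit.AtomisticToContinuum.Crystallization.Theorems.OverbindingBudgetAffineFirmDescent.Brief

open scoped BigOperators Classical RealInnerProductSpace
open Literature.MathematicalPhysics.StatisticalMechanics
open Literature.Geometry.DiscreteGeometry (nearestDist nearestDist_nonneg nearestDist_le_dist)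
open Summit.AtomisticToContinuum.Crystallization.Theorems.OverbindingBudgetMisfitWindowStatements (InWindow offCount)
open Summit.AtomisticToContinuum.Crystallization.Theorems.OverbindingBudgetBalancedCensusStatements
open Summit.AtomisticToContinuum.Crystallization.Theorems.OverbindingBudgetAffineTwinCut
open Summit.AtomisticToContinuum.Crystallization.Theorems.OverbindingBudgetAffineFirmDescent
open Summit.AtomisticToContinuum.Crystallization.Theorems.FrustratedLawDichotomyNashStabilityCalculus

variable {N : ℕ}

/-! ## §0  Vocabulary of the proof -/

/-- A DESTABILISING MOVE at `j`: the negation of `FirmStable δ κ Ls y j` unfolded — a move `d` supported on in-window sites of the `Ls·nn_j`-ball,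
of amplitude `≤ Ls·nn_j`, keeping `y + d` injective, and lowering the energy by MORE than `κ`. -/
def IsFirmWitness (δ κ Ls : ℝ) (y : Fin N → EuclideanSpace ℝ (Fin 3)) (j : Fin N) (d : Fin N → EuclideanSpace ℝ (Fin 3)) : Prop :=
  (∀ k : Fin N, d k ≠ 0 → dist (y k) (y j) ≤ Ls * nearestDist y j ∧ InWindow δ 2 y k) ∧
  (∀ k : Fin N, ‖d k‖ ≤ Ls * nearestDist y j) ∧
  Function.Injective (y + d) ∧
  interactionEnergy lennardJones (y + d) + κ < interactionEnergy lennardJones y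

/-- The MIXED second difference of one pair term `V_LJ(‖·‖)` at relative position `r`, when the first site moves by `u` and the second by `w`:
`X(r; u, w) = V(|r + u − w|) − V(|r + u|) − V(|r − w|) + V(|r|)`. -/
noncomputable def mixedDiff (r u w : EuclideanSpace ℝ (Fin 3)) : ℝ :=
  lennardJones ‖r + u - w‖ - lennardJones ‖r + u‖ - lennardJones ‖r - w‖ + lennardJones ‖r‖

/-- The support of a move. -/
noncomputable def supp (d : Fin N → EuclideanSpace ℝ (Fin 3)) : Finset (Fin N) :=
  Finset.univ.filter fun k => d k ≠ 0

/-- The CROSS SUM of a family of moves `w j` (`j ∈ F`) applied simultaneously to `y`: the mixed second differences over ordered pairs of sites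
lying in the supports of two DISTINCT members. -/
noncomputable def crossSum (y : Fin N → EuclideanSpace ℝ (Fin 3)) (w : Fin N → Fin N → EuclideanSpace ℝ (Fin 3)) (F : Finset (Fin N)) : ℝ :=
  ∑ j ∈ F, ∑ j' ∈ F.erase j, ∑ a ∈ supp (w j), ∑ b ∈ supp (w j'), mixedDiff (y a - y b) (w j a) (w j' b)

/-- The TAIL LENGTH `T(δ, κ, Ls) = (6 144 000 · (4Ls/δ + 1)³ · Ls² / (δ³ κ))^{1/5}` (`= 0` when `Ls = 0`): the distance beyond which the cross terms
of one member against all others sum to `≤ κ` (memo L8). -/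
noncomputable def tailLen (δ κ Ls : ℝ) : ℝ :=
  (6144000 * (4 * Ls / δ + 1) ^ 3 * Ls ^ 2 / (δ ^ 3 * κ)) ^ (1 / 5 : ℝ)

/-- The FAMILY SEPARATION `Dsep(δ, κ, Ls) = 12·Ls + δ + 2 + T(δ, κ, Ls)`. -/
noncomputable def Dsep (δ κ Ls : ℝ) : ℝ :=
  12 * Ls + δ + 2 + tailLen δ κ Ls

/-! ## §1  The five lemma statements (verbatim from the g106 skeleton; proved in §3–§6) -/

/-- **L1 · separated subfamily with packing count** [combinatorics + volume packing · S–M]: inside a finite family of sites whose positions are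
pairwise `≥ δ` apart there is a sub-family with positions pairwise `> D` apart and `#U ≤ (2D/δ + 1)³ · #F` (a MAXIMAL `D`-separated sub-family:
every site of `U` is within `D` of a member; `card_le_of_separated_of_dist_le` with `finrank ℝ (EuclideanSpace ℝ (Fin 3)) = 3` per member). -/
def SeparatedSubfamily : Prop :=
  ∀ (δ D : ℝ), 0 < δ → 0 ≤ D → ∀ (N : ℕ) (y : Fin N → EuclideanSpace ℝ (Fin 3)) (U : Finset (Fin N)),
    (∀ j ∈ U, ∀ j' ∈ U, j ≠ j' → δ ≤ dist (y j) (y j')) →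
    ∃ F : Finset (Fin N), F ⊆ U ∧ (∀ j ∈ F, ∀ j' ∈ F, j ≠ j' → D < dist (y j) (y j')) ∧
      (U.card : ℝ) ≤ (2 * D / δ + 1) ^ 3 * (F.card : ℝ)

/-- **L2 · the mixed second-difference bound** [calculus · M]: if every point of the parallelogram `{r + s·u − t·w : s, t ∈ [0,1]}` has norm `≥ m ≥ 1`
(guaranteed by `‖u‖ + ‖w‖ + m ≤ ‖r‖`), then `|X(r; u, w)| ≤ 24 · m⁻⁸ · ‖u‖ · ‖w‖` — the Hessian of `x ↦ V_LJ(|x|) = G(|x|²)` is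
`2G′(s)·I + 4G″(s)·x⊗x` (`s = |x|²`, `G′ = tildeV_deriv`, `G″` as in `abs_tildeV_deriv2_le`), of operator norm `≤ |x|⁻⁸ + 14|x|⁻⁸ ≤ 24|x|⁻⁸` for `|x| ≥ 1`. -/
def MixedDiffBound : Prop :=
  ∀ (r u w : EuclideanSpace ℝ (Fin 3)) (m : ℝ), 1 ≤ m → ‖u‖ + ‖w‖ + m ≤ ‖r‖ →
    |mixedDiff r u w| ≤ 24 * m⁻¹ ^ 8 * ‖u‖ * ‖w‖

/-- **L3 · the pair-sum identity** [finite-sum algebra · M]: for moves `w j` (`j ∈ F`) with pairwise DISJOINT supports,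
`2(E(y + Σ_j w j) − E(y)) = 2 Σ_j (E(y + w j) − E(y)) + crossSum` (`two_mul_interactionEnergy_eq_sum_sum` with `lennardJones_zero`; pairs inside one
support or touching at most one support cancel exactly). -/
def PairSumIdentity : Prop :=
  ∀ (N : ℕ) (y : Fin N → EuclideanSpace ℝ (Fin 3)) (F : Finset (Fin N)) (w : Fin N → Fin N → EuclideanSpace ℝ (Fin 3)),
    (∀ j ∈ F, ∀ j' ∈ F, j ≠ j' → ∀ k : Fin N, w j k = 0 ∨ w j' k = 0) →
    2 * (interactionEnergy lennardJones (y + ∑ j ∈ F, w j) - interactionEnergy lennardJones y)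
      = 2 * ∑ j ∈ F, (interactionEnergy lennardJones (y + w j) - interactionEnergy lennardJones y) + crossSum y w F

/-- **L4 · joint injectivity** [metric case analysis · S]: `y` injective, each `y + w j` injective, `w j` supported within `2Ls` of `y j` with amplitude
`≤ 2Ls`, centres pairwise `> 8Ls` apart ⇒ `y + Σ_j w j` injective (moved clouds lie in the disjoint balls `B(y j, 4Ls)`; a collision inside one cloud or
between a cloud and an unmoved site contradicts the injectivity of that `y + w j`). -/
def JointInjective : Prop :=
  ∀ (Ls : ℝ), 0 ≤ Ls → ∀ (N : ℕ) (y : Fin N → EuclideanSpace ℝ (Fin 3)), Function.Injective y →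
    ∀ (F : Finset (Fin N)) (w : Fin N → Fin N → EuclideanSpace ℝ (Fin 3)),
    (∀ j ∈ F, Function.Injective (y + w j)) →
    (∀ j ∈ F, ∀ k : Fin N, w j k ≠ 0 → dist (y k) (y j) ≤ 2 * Ls) →
    (∀ j ∈ F, ∀ k : Fin N, ‖w j k‖ ≤ 2 * Ls) →
    (∀ j ∈ F, ∀ j' ∈ F, j ≠ j' → 8 * Ls < dist (y j) (y j')) →
    Function.Injective (y + ∑ j ∈ F, w j)

/-- **L5 · the cross sum of a `Dsep`-separated family costs `≤ κ` per member** [bookkeeping of L2 + `tail8_le` + packing · M]: supports in-window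
(hence `δ`-separated) within `2Ls` of their centres, amplitudes `≤ 2Ls`, centres pairwise `> Dsep(δ, κ, Ls)` apart.  Per ordered pair
`|X| ≤ 24·(|r| − 4Ls)⁻⁸(2Ls)² ≤ 24576·Ls²·|r|⁻⁸` (`|r| ≥ 8Ls`); per moved site the partners in other supports are `δ`-separated at distance
`≥ R₀ = Dsep − 4Ls`, so `Σ |r|⁻⁸ ≤ 250 δ⁻³ R₀⁻⁵` (`tail8_le`); `≤ (4Ls/δ + 1)³` moved sites per member; `R₀ ≥ T(δ, κ, Ls)` closes at `κ`. -/
def CrossSumBound : Prop :=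
  MixedDiffBound → ∀ (δ κ Ls : ℝ), 0 < δ → δ ≤ 2 → 0 < κ → 0 ≤ Ls →
    ∀ (N : ℕ) (y : Fin N → EuclideanSpace ℝ (Fin 3)) (F : Finset (Fin N)) (w : Fin N → Fin N → EuclideanSpace ℝ (Fin 3)),
    (∀ j ∈ F, ∀ k : Fin N, w j k ≠ 0 → dist (y k) (y j) ≤ 2 * Ls ∧ InWindow δ 2 y k) →
    (∀ j ∈ F, ∀ k : Fin N, ‖w j k‖ ≤ 2 * Ls) →
    (∀ j ∈ F, ∀ j' ∈ F, j ≠ j' → Dsep δ κ Ls < dist (y j) (y j')) →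
    crossSum y w F ≤ κ * (F.card : ℝ)

/-! ## §2  Proved glue (verbatim from the g106 skeleton) -/

/-- Unfolding `¬ FirmStable`: a destabilising move exists. [glue · XS] -/
theorem exists_witness_of_not_firmStable {δ κ Ls : ℝ} {y : Fin N → EuclideanSpace ℝ (Fin 3)} {j : Fin N}
    (h : ¬ FirmStable δ κ Ls y j) : ∃ d : Fin N → EuclideanSpace ℝ (Fin 3), IsFirmWitness δ κ Ls y j d := by
  by_contra hne
  apply h
  intro d h1 h2 h3
  by_contra hle
  exact hne ⟨d, h1, h2, h3, lt_of_not_ge hle⟩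

/-- The `r⁻⁸` TAIL over a separated set beyond a radius: points pairwise `≥ η` apart, all at distance `≥ ρ ≥ η > 0` from `p` ⇒
`Σ |p − z|⁻⁸ ≤ 250 η⁻³ ρ⁻⁵` (`sum_inv_pow_six_le_two_scale` and `|p − z|⁻⁸ ≤ ρ⁻²|p − z|⁻⁶`). [glue · XS] -/
theorem tail8_le (t : Finset (EuclideanSpace ℝ (Fin 3))) (p : EuclideanSpace ℝ (Fin 3)) {η ρ : ℝ} (hη : 0 < η) (hηρ : η ≤ ρ)
    (ht : ∀ z ∈ t, ∀ w ∈ t, z ≠ w → η ≤ dist z w) (hp : ∀ z ∈ t, ρ ≤ dist p z) :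
    ∑ z ∈ t, (dist p z)⁻¹ ^ 8 ≤ 250 * η⁻¹ ^ 3 * ρ⁻¹ ^ 5 := by
  have hρ : 0 < ρ := hη.trans_le hηρ
  have hpt : ∀ z ∈ t, (dist p z)⁻¹ ^ 8 ≤ ρ⁻¹ ^ 2 * (dist p z)⁻¹ ^ 6 := by
    intro z hz
    have h1 : (dist p z)⁻¹ ≤ ρ⁻¹ := inv_anti₀ hρ (hp z hz)
    have h2 : 0 ≤ (dist p z)⁻¹ := inv_nonneg.2 dist_nonneg
    have h3 : (dist p z)⁻¹ ^ 2 ≤ ρ⁻¹ ^ 2 := pow_le_pow_left₀ h2 h1 2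
    calc (dist p z)⁻¹ ^ 8 = (dist p z)⁻¹ ^ 2 * (dist p z)⁻¹ ^ 6 := by ring
      _ ≤ ρ⁻¹ ^ 2 * (dist p z)⁻¹ ^ 6 := mul_le_mul_of_nonneg_right h3 (pow_nonneg h2 6)
  calc ∑ z ∈ t, (dist p z)⁻¹ ^ 8 ≤ ∑ z ∈ t, ρ⁻¹ ^ 2 * (dist p z)⁻¹ ^ 6 := Finset.sum_le_sum hpt
    _ = ρ⁻¹ ^ 2 * ∑ z ∈ t, (dist p z)⁻¹ ^ 6 := by rw [Finset.mul_sum]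
    _ ≤ ρ⁻¹ ^ 2 * (250 * η⁻¹ ^ 3 * ρ⁻¹ ^ 3) :=
        mul_le_mul_of_nonneg_left (sum_inv_pow_six_le_two_scale t p hη hηρ ht hp) (pow_nonneg (inv_nonneg.2 hρ.le) 2)
    _ = 250 * η⁻¹ ^ 3 * ρ⁻¹ ^ 5 := by ring

/-- The BARE census: `N·e⋆ + c·cnt ≤ E` at every injective `y` is `CensusW cnt reb σ₁ σ₂` with `C = 0` (direction `e0`). [glue · XS] -/
theorem censusW_of_bare {cnt reb : ∀ {N : ℕ}, (Fin N → EuclideanSpace ℝ (Fin 3)) → ℕ} {σ₁ σ₂ c : ℝ} (hc : 0 < c)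
    (h : ∀ (N : ℕ) (y : Fin N → EuclideanSpace ℝ (Fin 3)), Function.Injective y →
      (N : ℝ) * (⨅ Q : PeriodicConfiguration 3, Q.energyPerParticle lennardJones) + c * (cnt y : ℝ) ≤ interactionEnergy lennardJones y) :
    CensusW cnt reb σ₁ σ₂ := by
  refine ⟨c, 0, hc, fun N y hy => ⟨e0, norm_e0, ?_⟩⟩
  have h' := h N y hy
  simp only [zero_mul, sub_zero]
  exact h'

/-- Supports within `2Ls` of centres that are `> 8Ls` apart are pairwise DISJOINT. [glue · XS] -/
theorem disjoint_supports {Ls : ℝ} (hLs : 0 ≤ Ls) {y : Fin N → EuclideanSpace ℝ (Fin 3)} {F : Finset (Fin N)}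
    {w : Fin N → Fin N → EuclideanSpace ℝ (Fin 3)}
    (hsupp : ∀ j ∈ F, ∀ k : Fin N, w j k ≠ 0 → dist (y k) (y j) ≤ 2 * Ls)
    (hsep : ∀ j ∈ F, ∀ j' ∈ F, j ≠ j' → 8 * Ls < dist (y j) (y j')) :
    ∀ j ∈ F, ∀ j' ∈ F, j ≠ j' → ∀ k : Fin N, w j k = 0 ∨ w j' k = 0 := by
  intro j hj j' hj' hne k
  by_contra h
  obtain ⟨h1, h2⟩ := not_or.mp h
  have d1 := hsupp j hj k h1
  have d2 := hsupp j' hj' k h2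
  have d3 := hsep j hj j' hj' hne
  have tri := dist_triangle_left (y j) (y j') (y k)
  linarith

/-- `firmUnstableCount` is the cardinality of the filtered finset. [glue · XS] -/
theorem firmUnstableCount_eq_card (δ κ Ls : ℝ) (y : Fin N → EuclideanSpace ℝ (Fin 3)) :
    firmUnstableCount δ κ Ls y = (Finset.univ.filter fun j => FirmUnstable δ κ Ls y j).card := by
  unfold firmUnstableCount
  simp only [Nat.card_eq_fintype_card, Fintype.card_subtype]

/-! ## §3  L1 `SeparatedSubfamily` and L4 `JointInjective` -/

/-- **L1 · `SeparatedSubfamily`** (PROVED). -/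
theorem separatedSubfamily : SeparatedSubfamily := by
  intro δ D hδ hD N y U hU
  -- a `D`-separated sub-family of maximal cardinality
  obtain ⟨good, hgood⟩ : ∃ good : Finset (Finset (Fin N)),
      good = U.powerset.filter (fun S => ∀ j ∈ S, ∀ j' ∈ S, j ≠ j' → D < dist (y j) (y j')) := ⟨_, rfl⟩
  have hne : good.Nonempty := by
    refine ⟨∅, ?_⟩
    rw [hgood, Finset.mem_filter]
    exact ⟨Finset.empty_mem_powerset U, fun j hj => absurd hj (Finset.notMem_empty j)⟩
  obtain ⟨F, hFgood, hmax⟩ := Finset.exists_max_image good Finset.card hne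
  have hFgood' := hFgood
  rw [hgood, Finset.mem_filter, Finset.mem_powerset] at hFgood'
  obtain ⟨hFU, hFsep⟩ := hFgood'
  refine ⟨F, hFU, hFsep, ?_⟩
  -- maximality ⇒ covering within `D`
  have hcover : ∀ j ∈ U, ∃ f ∈ F, dist (y j) (y f) ≤ D := by
    intro j hj
    by_contra hno
    have hfar : ∀ f ∈ F, D < dist (y j) (y f) := fun f hf => lt_of_not_ge fun h => hno ⟨f, hf, h⟩
    have hjF : j ∉ F := by
      intro h
      have := hfar j h
      rw [dist_self] at this
      linarith
    have hins : insert j F ∈ good := by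
      rw [hgood, Finset.mem_filter, Finset.mem_powerset]
      refine ⟨Finset.insert_subset hj hFU, ?_⟩
      intro a ha b hb hab
      rw [Finset.mem_insert] at ha hb
      rcases ha with rfl | ha
      · rcases hb with rfl | hb
        · exact absurd rfl hab
        · exact hfar b hb
      · rcases hb with rfl | hb
        · rw [dist_comm]; exact hfar a ha
        · exact hFsep a ha b hb hab
    have h1 := hmax _ hins
    have h2 := Finset.card_lt_card (Finset.ssubset_insert hjF)
    omega
  -- counting: `U ⊆ ⋃_{f ∈ F}` fibres, each fibre `δ`-separated inside the `D`-ball about `y f`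
  have hUsub : U ⊆ F.biUnion (fun f => U.filter (fun j => dist (y j) (y f) ≤ D)) := by
    intro j hj
    obtain ⟨f, hf, hjf⟩ := hcover j hj
    exact Finset.mem_biUnion.mpr ⟨f, hf, Finset.mem_filter.mpr ⟨hj, hjf⟩⟩
  have hfib : ∀ f ∈ F, (((U.filter (fun j => dist (y j) (y f) ≤ D)).card : ℕ) : ℝ) ≤ (2 * D / δ + 1) ^ 3 := by
    intro f _
    obtain ⟨S, hS⟩ : ∃ S : Finset (Fin N), S = U.filter (fun j => dist (y j) (y f) ≤ D) := ⟨_, rfl⟩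
    rw [← hS]
    have hSU : S ⊆ U := by rw [hS]; exact Finset.filter_subset _ _
    have hinjS : Set.InjOn y ↑S := by
      intro a ha b hb hab
      by_contra hne
      have := hU a (hSU ha) b (hSU hb) hne
      rw [hab, dist_self] at this
      linarith
    have hpack := card_le_of_separated_of_dist_le (S.image y) (y f) hδ hD
      (by
        intro c hc
        obtain ⟨a, ha, rfl⟩ := Finset.mem_image.mp hc
        rw [hS] at ha
        exact (Finset.mem_filter.mp ha).2)
      (by
        intro c hc d hd hcd
        obtain ⟨a, ha, rfl⟩ := Finset.mem_image.mp hc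
        obtain ⟨b, hb, rfl⟩ := Finset.mem_image.mp hd
        have hab : a ≠ b := fun h => hcd (by rw [h])
        exact hU a (hSU ha) b (hSU hb) hab)
    rw [Finset.card_image_of_injOn hinjS, finrank_euclideanSpace_fin] at hpack
    exact hpack
  have h1 : U.card ≤ ∑ f ∈ F, (U.filter (fun j => dist (y j) (y f) ≤ D)).card :=
    (Finset.card_le_card hUsub).trans Finset.card_biUnion_le
  have h2 : (U.card : ℝ) ≤ ∑ f ∈ F, ((U.filter (fun j => dist (y j) (y f) ≤ D)).card : ℝ) := by
    exact_mod_cast h1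
  calc (U.card : ℝ) ≤ ∑ f ∈ F, ((U.filter (fun j => dist (y j) (y f) ≤ D)).card : ℝ) := h2
    _ ≤ ∑ f ∈ F, (2 * D / δ + 1) ^ 3 := Finset.sum_le_sum hfib
    _ = (2 * D / δ + 1) ^ 3 * (F.card : ℝ) := by rw [Finset.sum_const, nsmul_eq_mul, mul_comm]

/-- **L4 · `JointInjective`** (PROVED). -/
theorem jointInjective : JointInjective := by
  intro Ls hLs N y hy F w hinj hsupp hamp hsep
  -- the supports are pairwise disjoint
  have hdisj : ∀ j ∈ F, ∀ j' ∈ F, j ≠ j' → ∀ k : Fin N, w j k = 0 ∨ w j' k = 0 := by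
    intro j hj j' hj' hne k
    by_contra h
    obtain ⟨h1, h2⟩ := not_or.mp h
    have d1 := hsupp j hj k h1
    have d2 := hsupp j' hj' k h2
    have d3 := hsep j hj j' hj' hne
    have tri := dist_triangle_left (y j) (y j') (y k)
    linarith
  -- the total move at a site: one member's move, or zero
  have hval : ∀ k : Fin N, ∀ j ∈ F, w j k ≠ 0 → (∑ i ∈ F, w i) k = w j k := by
    intro k j hj hk
    rw [Finset.sum_apply]
    exact Finset.sum_eq_single_of_mem j hj (fun j' hj' hne => (hdisj j hj j' hj' (Ne.symm hne) k).resolve_left hk)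
  have hzero : ∀ k : Fin N, (∀ j ∈ F, w j k = 0) → (∑ i ∈ F, w i) k = 0 := by
    intro k h
    rw [Finset.sum_apply]
    exact Finset.sum_eq_zero h
  -- a moved point stays within `4Ls` of its member's centre
  have hcloud : ∀ j ∈ F, ∀ k : Fin N, w j k ≠ 0 → dist (y k + w j k) (y j) ≤ 4 * Ls := by
    intro j hj k hk
    calc dist (y k + w j k) (y j) ≤ dist (y k + w j k) (y k) + dist (y k) (y j) := dist_triangle _ _ _
      _ = ‖w j k‖ + dist (y k) (y j) := by rw [dist_eq_norm, add_sub_cancel_left]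
      _ ≤ 2 * Ls + 2 * Ls := add_le_add (hamp j hj k) (hsupp j hj k hk)
      _ = 4 * Ls := by ring
  intro a b hab
  simp only [Pi.add_apply] at hab
  by_cases hma : ∃ j ∈ F, w j a ≠ 0
  · obtain ⟨j, hj, hja⟩ := hma
    rw [hval a j hj hja] at hab
    by_cases hmb : ∃ j' ∈ F, w j' b ≠ 0
    · obtain ⟨j', hj', hj'b⟩ := hmb
      rw [hval b j' hj' hj'b] at hab
      by_cases hjj : j = j'
      · subst hjj
        exact hinj j hj (by simp only [Pi.add_apply]; exact hab)
      · exfalso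
        have h1 := hcloud j hj a hja
        have h2 := hcloud j' hj' b hj'b
        rw [hab] at h1
        have h3 := hsep j hj j' hj' hjj
        have tri := dist_triangle_left (y j) (y j') (y b + w j' b)
        linarith
    · have hb0 : ∀ j' ∈ F, w j' b = 0 := by
        intro j' hj'
        by_contra h
        exact hmb ⟨j', hj', h⟩
      rw [hzero b hb0] at hab
      exact hinj j hj (by simp only [Pi.add_apply]; rw [hab, hb0 j hj])
  · have ha0 : ∀ j ∈ F, w j a = 0 := by
      intro j hj
      by_contra h
      exact hma ⟨j, hj, h⟩
    rw [hzero a ha0] at hab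
    by_cases hmb : ∃ j' ∈ F, w j' b ≠ 0
    · obtain ⟨j', hj', hj'b⟩ := hmb
      rw [hval b j' hj' hj'b] at hab
      exact hinj j' hj' (by simp only [Pi.add_apply]; rw [ha0 j' hj', hab])
    · have hb0 : ∀ j' ∈ F, w j' b = 0 := by
        intro j' hj'
        by_contra h
        exact hmb ⟨j', hj', h⟩
      rw [hzero b hb0] at hab
      exact hy (by simpa using hab)


end Summit.AtomisticToContinuum.Crystallization.Theorems.OverbindingBudgetAffineFirmDescent.Brief
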